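import Summits.KontsevichZagierPeriods.KontsevichZagierPeriods.Theses.SymplecticScissors
import Summits.KontsevichZagierPeriods.KontsevichZagierPeriods.Theorems.SymplecticScissorsTypeAGenerationRatOneVarLayer
import Summits.KontsevichZagierPeriods.KontsevichZagierPeriods.Theorems.SymplecticScissorsTypeAGenerationStubBinGermMemOan
import Summits.KontsevichZagierPeriods.KontsevichZagierPeriods.Theorems.SymplecticScissorsTypeAGenerationStubBinGermCalculus
import Summits.KontsevichZagierPeriods.KontsevichZagierPeriods.Theorems.SymplecticScissorsTypeAGenerationStubBinGermValues
import Summits.KontsevichZagierPeriods.KontsevichZagierPeriods.Theorems.SymplecticScissorsTypeAGenerationStubPartialFractions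
import Literature.NumberTheory.Transcendental.AyoubPeriodSeries
import Literature.NumberTheory.Transcendental.AyoubPeriodSeriesKernel
import Literature.NumberTheory.Transcendental.AyoubPeriodSeriesPiAlgebraic
import Literature.NumberTheory.Transcendental.AyoubPeriodSeriesLocalizing
import Literature.NumberTheory.Transcendental.AyoubPeriodSeriesTorsion
import Mathlib.RingTheory.Polynomial.Tower
import Mathlib.Analysis.SpecialFunctions.Complex.Log

/-!
# `TypeAGeneration` (stmt-KontsevichZagierPeriods-18392), line `Sketch`, stub
`stub_barrierElementTypeA` (F7) — the barrier catalogue's element is type (a)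

Registered stub `stub_barrierElementTypeA` of the crux `TypeAGeneration` (route SymplecticScissors,
line `Sketch` = card stokes-compiler), on top of
`Literature/NumberTheory/Transcendental/AyoubPeriodSeries.lean` (`AyoubRel.CSeries = ℂ[[z₀, z₁, …]]`,
`AyoubRel.Oan σ = 𝒪_{k-alg}(𝔻̄^∞)`, `AyoubRel.intC = ∫_{[0,1]^∞}`, `AyoubRel.relAC` = the type-(a)
operator `G ↦ ∂G/∂zₙ − G|_{zₙ=1} + G|_{zₙ=0}`).

With the pole germ `p(α) := (−α⁻¹)·(1 − z₀/α)⁻¹ = 1/(z₀ − α)` (`binGerm[0, α, −1]` rescaled), the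
element
`F = p(2) − p(√2) − p(−√2) = 1/(z₀ − 2) − 1/(z₀ − √2) − 1/(z₀ + √2) = 2z₀/(2 − z₀²) − 1/(2 − z₀)`
is the one-variable element of the barrier catalogue
(`Literature.Barriers.KontsevichZagierPeriods.KZ.kernelElt_not_stokes_one_variable`: it has no
ONE-variable Stokes certificate). Here we show that it nevertheless lies in the `ℚ`-span of the
type-(a) elements of `𝒪_{ℚ-alg}(𝔻̄^∞)` (auxiliary variables allowed), as the showcase instance of
the landed LAYER 1 theorem `stub_ratOneVarLayer` (Ayoub's Conjecture 1.1 for one-variable rational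
integrands, `…TypeAGenerationRatOneVarLayer.lean`):

* `F ∈ 𝒪_{ℚ-alg}(𝔻̄^∞)` (`l1_poleGerm_mem_Oan`: `2, ±√2` are algebraic of modulus `> 1`) and
  involves only `z₀`;
* `F` is rational with rational coefficients: `(z₀³ − 2z₀² − 2z₀ + 4)·F = −z₀² + 4z₀ − 2`
  (`(z₀ − α)·p(α) = 1`, `pb_pole`, and `√2·√2 = 2`);
* `∫ F = Log(1 − 1/2) − Log(1 − 1/√2) − Log(1 + 1/√2) = log(1/2) − log((1 − 1/√2)(1 + 1/√2)) = 0`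
  (`stub_binGermValues`: `∫ p(α) = Log(1 − α⁻¹)`).

Elementary bookkeeping on top of the landed rungs; no definition is introduced.
References: Ayoub, Ann. of Math. 181 (2015), Conj. 1.1; Fresán 2024, Conj. 3.5.
-/

noncomputable section

-- `Summit.KontsevichZagierPeriods.KontsevichZagierPeriods.…` is the tree's mandated layout (single-conjunct summit).
set_option linter.dupNamespace false

namespace Summit.KontsevichZagierPeriods.KontsevichZagierPeriods.TypeAGenerationLine

open Finsupp MvPowerSeries
open Literature.NumberTheory.Transcendental
open Literature.NumberTheory.Transcendental.AyoubRel

/-- The binomial germ `(1 − zᵢ/α)^a ∈ ℂ[[z]]`. -/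
local notation3 "binGerm[" i ", " α ", " a "]" =>
  (MvPowerSeries.rename (⇑(axisEmb i))
    (PowerSeries.rescale (-(α : ℂ)⁻¹) (PowerSeries.binomialSeries ℂ (a : ℂ)) : MvPowerSeries Unit ℂ) :
    CSeries)

/-! ## The scalars `2` and `√2` -/

/-- `‖√2‖ > 1` in `ℂ`. [folklore] -/
theorem f7_norm_sqrt_two : 1 < ‖((Real.sqrt 2 : ℝ) : ℂ)‖ := by
  rw [Complex.norm_of_nonneg (Real.sqrt_nonneg 2), Real.lt_sqrt zero_le_one]
  norm_num

/-- `‖2‖ > 1` in `ℂ`. [folklore] -/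
theorem f7_norm_two : 1 < ‖(2 : ℂ)‖ := by
  rw [Complex.norm_two]; norm_num

/-! ## The pole germs `p(α) = 1/(z₀ − α)` -/

/-- `(z₀ − α) · p(α) = 1` for the pole germ `p(α) = (−α⁻¹)(1 − z₀/α)⁻¹` (`pb_pole` with the binomial
germ calculus G2). [folklore] -/
theorem f7_pole (α : ℂ) (hα : α ≠ 0) :
    (X 0 - C α) * ((-α⁻¹) • binGerm[0, α, (-1 : ℂ)]) = 1 :=
  pb_pole 0 hα (g2_binGerm_add 0 α) (g2_binGerm_zero 0 α) (g2_binGerm_one 0 α)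

/-- **The integral vanishes**: `Log(1 − 1/2) − Log(1 − 1/√2) − Log(1 − (−√2)⁻¹)
= log(1/2) − log((1 − 1/√2)(1 + 1/√2)) = log(1/2) − log(1/2) = 0` (all arguments are positive
reals). [folklore] -/
theorem f7_log_identity :
    Complex.log (1 - (2 : ℂ)⁻¹) - Complex.log (1 - ((Real.sqrt 2 : ℝ) : ℂ)⁻¹)
      - Complex.log (1 - (-((Real.sqrt 2 : ℝ) : ℂ))⁻¹) = 0 := by
  set t : ℝ := Real.sqrt 2 with ht
  have htt : t * t = 2 := Real.mul_self_sqrt (by norm_num)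
  have ht1 : 1 < t := by rw [ht, Real.lt_sqrt zero_le_one]; norm_num
  have hlt : t⁻¹ < 1 := inv_lt_one_of_one_lt₀ ht1
  have hpos1 : 0 < 1 - t⁻¹ := sub_pos.mpr hlt
  have hpos2 : 0 < 1 + t⁻¹ := by positivity
  have e1 : (1 : ℂ) - (2 : ℂ)⁻¹ = ((2⁻¹ : ℝ) : ℂ) := by push_cast; norm_num
  have e2 : (1 : ℂ) - ((t : ℝ) : ℂ)⁻¹ = ((1 - t⁻¹ : ℝ) : ℂ) := by push_cast; ring
  have e3 : (1 : ℂ) - (-((t : ℝ) : ℂ))⁻¹ = ((1 + t⁻¹ : ℝ) : ℂ) := by push_cast; ring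
  rw [e1, e2, e3, ← Complex.ofReal_log (by norm_num), ← Complex.ofReal_log hpos1.le,
    ← Complex.ofReal_log hpos2.le, ← Complex.ofReal_sub, ← Complex.ofReal_sub,
    Complex.ofReal_eq_zero, sub_sub, ← Real.log_mul hpos1.ne' hpos2.ne']
  have key : (1 - t⁻¹) * (1 + t⁻¹) = 2⁻¹ := by
    have : (1 - t⁻¹) * (1 + t⁻¹) = 1 - (t * t)⁻¹ := by ring
    rw [this, htt]; norm_num
  rw [key, sub_self]

/-! ## Rationality: `(z₀³ − 2z₀² − 2z₀ + 4) · F = −z₀² + 4z₀ − 2` -/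

/-- The denominator `X³ − 2X² − 2X + 4 = (X − 2)(X² − 2) ∈ ℚ[X]` is non-zero (its cubic
coefficient is `1`). [folklore] -/
theorem f7_B_ne_zero :
    (Polynomial.X ^ 3 - Polynomial.C 2 * Polynomial.X ^ 2 - Polynomial.C 2 * Polynomial.X
      + Polynomial.C 4 : Polynomial ℚ) ≠ 0 := by
  intro h
  have h3 := congrArg (fun p : Polynomial ℚ => p.coeff 3) h
  simp at h3

/-- **Rationality of the barrier element**: with `B = z₀³ − 2z₀² − 2z₀ + 4 = (z₀ − 2)(z₀ − √2)(z₀ + √2)`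
and `A = −z₀² + 4z₀ − 2 = (z₀² − 2) − (z₀ − 2)(z₀ + √2) − (z₀ − 2)(z₀ − √2)`,
`B · (p(2) − p(√2) − p(−√2)) = A` in `ℂ[[z]]` (from `(z₀ − α)·p(α) = 1` and `√2·√2 = 2`).
[folklore] -/
theorem f7_rational :
    Polynomial.aeval (X 0 : CSeries)
        ((Polynomial.X ^ 3 - Polynomial.C 2 * Polynomial.X ^ 2 - Polynomial.C 2 * Polynomial.X
          + Polynomial.C 4 : Polynomial ℚ).map (algebraMap ℚ ℂ)) *
      ((-(2 : ℂ)⁻¹) • binGerm[0, (2 : ℂ), (-1 : ℂ)]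
        - (-((Real.sqrt 2 : ℝ) : ℂ)⁻¹) • binGerm[0, ((Real.sqrt 2 : ℝ) : ℂ), (-1 : ℂ)]
        - (-(-((Real.sqrt 2 : ℝ) : ℂ))⁻¹) • binGerm[0, (-((Real.sqrt 2 : ℝ) : ℂ)), (-1 : ℂ)]) =
    Polynomial.aeval (X 0 : CSeries)
        ((-Polynomial.X ^ 2 + Polynomial.C 4 * Polynomial.X - Polynomial.C 2 : Polynomial ℚ).map
          (algebraMap ℚ ℂ)) := by
  set s : ℂ := ((Real.sqrt 2 : ℝ) : ℂ) with hs
  have hs0 : s ≠ 0 := by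
    rw [hs, Ne, Complex.ofReal_eq_zero]
    exact (Real.sqrt_pos.mpr two_pos).ne'
  set p2 : CSeries := (-(2 : ℂ)⁻¹) • binGerm[0, (2 : ℂ), (-1 : ℂ)] with hp2
  set ps : CSeries := (-s⁻¹) • binGerm[0, s, (-1 : ℂ)] with hps
  set pm : CSeries := (-(-s)⁻¹) • binGerm[0, (-s), (-1 : ℂ)] with hpm
  -- the three unit equations `(z₀ − α) · p(α) = 1` and `√2 · √2 = 2`
  have h2 : (X 0 - 2) * p2 = 1 := by
    have h := f7_pole 2 two_ne_zero
    rwa [map_ofNat] at h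
  have hs1 : (X 0 - C s) * ps = 1 := f7_pole s hs0
  have hm1 : (X 0 + C s) * pm = 1 := by
    have h := f7_pole (-s) (neg_ne_zero.mpr hs0)
    rwa [map_neg, sub_neg_eq_add] at h
  have hss : (C s : CSeries) * C s = 2 := by
    rw [← map_mul, hs, ← Complex.ofReal_mul, Real.mul_self_sqrt zero_le_two, Complex.ofReal_ofNat,
      map_ofNat]
  rw [Polynomial.aeval_map_algebraMap, Polynomial.aeval_map_algebraMap]
  simp only [map_add, map_sub, map_neg, map_mul, map_pow, Polynomial.aeval_X, map_ofNat]
  linear_combination (X 0 ^ 2 - 2) * h2 - ((X 0 - 2) * (X 0 + C s)) * hs1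
    - ((X 0 - 2) * (X 0 - C s)) * hm1 - ((X 0 - 2) * (ps + pm)) * hss

/-! ## The stub -/

/-- **F7 `stub_barrierElementTypeA` — the barrier catalogue's element is type (a).**
The one-variable element `F = 1/(z₀ − 2) − 1/(z₀ − √2) − 1/(z₀ + √2) = 2z₀/(2 − z₀²) − 1/(2 − z₀)`
(written with the pole germs `p(α) = (−α⁻¹)(1 − z₀/α)⁻¹`), which has no one-variable Stokes
certificate (`Literature.Barriers.KontsevichZagierPeriods.KZ.kernelElt_not_stokes_one_variable`),
lies in the `ℚ`-span of the type-(a) elements `∂G/∂zₙ − G|_{zₙ=1} + G|_{zₙ=0}`,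
`G ∈ 𝒪_{ℚ-alg}(𝔻̄^∞)`: an instance of LAYER 1 `stub_ratOneVarLayer` (Ayoub's Conjecture 1.1 for
one-variable rational integrands) — `F ∈ 𝒪_{ℚ-alg}(𝔻̄^∞)` involves only `z₀`,
`(z₀³ − 2z₀² − 2z₀ + 4)·F = −z₀² + 4z₀ − 2`, and
`∫ F = log(1/2) − log((1 − 1/√2)(1 + 1/√2)) = 0`. [cite: Ayoub2015, Conj. 1.1] -/
theorem stub_barrierElementTypeA :
    ((-(2 : ℂ)⁻¹) • binGerm[0, (2 : ℂ), (-1 : ℂ)]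
      - (-((Real.sqrt 2 : ℝ) : ℂ)⁻¹) • binGerm[0, ((Real.sqrt 2 : ℝ) : ℂ), (-1 : ℂ)]
      - (-(-((Real.sqrt 2 : ℝ) : ℂ))⁻¹) • binGerm[0, (-((Real.sqrt 2 : ℝ) : ℂ)), (-1 : ℂ)]) ∈
      kSpan (algebraMap ℚ ℂ) {x : CSeries | ∃ G ∈ Oan (algebraMap ℚ ℂ), ∃ n : ℕ, x = relAC n G} := by
  have hn : 1 < ‖-((Real.sqrt 2 : ℝ) : ℂ)‖ := by rw [norm_neg]; exact f7_norm_sqrt_two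
  -- (1) `2, ±√2 ∈ ℚ̄` have modulus `> 1`, so the three pole germs lie in `𝒪_{ℚ-alg}(𝔻̄^∞)`
  have ha2 : IsAlgebraic ℚ (2 : ℂ) := by simpa using isAlgebraic_nat (R := ℚ) (A := ℂ) 2
  have has : IsAlgebraic ℚ ((Real.sqrt 2 : ℝ) : ℂ) := by
    refine IsAlgebraic.of_pow two_pos ?_
    rwa [← Complex.ofReal_pow, Real.sq_sqrt zero_le_two, Complex.ofReal_ofNat]
  have hO2 := l1_poleGerm_mem_Oan 0 ha2 f7_norm_two
  have hOs := l1_poleGerm_mem_Oan 0 has f7_norm_sqrt_two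
  have hOm := l1_poleGerm_mem_Oan 0 has.neg hn
  have hF := sub_mem_Oan _ (sub_mem_Oan _ hO2 hOs) hOm
  -- (5) Layer 1, fed with (2) one variable, (3) rationality and (4) `∫ F = 0`
  refine stub_ratOneVarLayer ℚ (algebraMap ℚ ℂ) (fun c => isAlgebraic_algebraMap c) 0 _ hF ?_
    ⟨_, _, (Polynomial.map_ne_zero_iff (algebraMap ℚ ℂ).injective).mpr f7_B_ne_zero,
      fun n => ?_, fun n => ?_, f7_rational⟩ ?_
  · -- (2) only `z₀` is involved
    intro l hl
    rcases usesVar_sub hl with h | h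
    · rcases usesVar_sub h with h | h
      · exact g1_eq_of_usesVar_binGerm (usesVar_of_smul h)
      · exact g1_eq_of_usesVar_binGerm (usesVar_of_smul h)
    · exact g1_eq_of_usesVar_binGerm (usesVar_of_smul h)
  · -- (3) the coefficients of `A`, `B ∈ ℚ[X]` are algebraic
    rw [Polynomial.coeff_map]; exact isAlgebraic_algebraMap _
  · rw [Polynomial.coeff_map]; exact isAlgebraic_algebraMap _
  · -- (4) `∫ F = Log(1 − 1/2) − Log(1 − 1/√2) − Log(1 + 1/√2) = 0`
    rw [intC_sub (summable_norm_coeff_of_mem_Oan _ (sub_mem_Oan _ hO2 hOs))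
      (summable_norm_coeff_of_mem_Oan _ hOm),
      intC_sub (summable_norm_coeff_of_mem_Oan _ hO2) (summable_norm_coeff_of_mem_Oan _ hOs),
      (stub_binGermValues 0 2 f7_norm_two).2,
      (stub_binGermValues 0 _ f7_norm_sqrt_two).2, (stub_binGermValues 0 _ hn).2]
    exact f7_log_identity

end Summit.KontsevichZagierPeriods.KontsevichZagierPeriods.TypeAGenerationLine
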